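import Summits.RiemannHypothesis.RiemannHypothesis.Theorems.HardyZLehmerSplitSigmaLLaguerreEnergyDrift
import Summits.RiemannHypothesis.RiemannHypothesis.Theorems.HardyZLehmerSplitSigmaLLaguerreOfOnLine
import Summits.RiemannHypothesis.RiemannHypothesis.Theses.HardyZLehmerSplit
import HarnessLib

/-!
# Crux `SigmaL` (stmt-RiemannHypothesis-24253) — energy identity, part 3: the registered stub and the
# crux BY NAME from an energy surplus; the stub's exact energy reformulation

Skeleton `SigmaL_birth`, registered stub `stub_laguerreAtCritical : ∀ t > 3·10¹², Z'(t) = 0 → Z(t) ≠ 0 →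
Z(t)·Z''(t) < 0` (RH-strength, OPEN). From the energy identity
(`Theorems/HardyZLehmerSplitSigmaLLaguerreEnergy.lean`: `(Z''Z − Z'²)/Z²(t) = Σₙ Re Zₙ(1, ½+it) + c'(t)`,
`c'(t) ≤ 4/t`, RH-free, for any Hadamard datum `D : SymmHadamardData riemannXi` — one exists by the tree's
`BasakThornerZaharescu2026.nonempty_symmHadamardData_riemannXi`):

* `laguerreAtCritical_of_energySurplus` — the registered stub's STATEMENT from "at every critical point
  `t > 3·10¹²` of `Z` with `Z(t) ≠ 0` the total zero energy exceeds the drift: `Σₙ Re Zₙ(1, ½+it) < −4/t`";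
* `SigmaL_of_energySurplus_critical`, `SigmaL_of_energySurplus` — the crux `SigmaL` BY NAME from the same
  surplus at critical points, resp. at every `t > 3·10¹²` with `Z(t) ≠ 0` (window form, via
  `noViolationOn_of_energy`);
* `laguerreAtCritical_iff_energy_all` — the registered stub's statement is EQUIVALENT to
  "`Σₙ Re Zₙ(1, ½+it) + c'(t) < 0` at every critical point `t > 3·10¹²` with `Z(t) ≠ 0`" (exact, no slack);
* `laguerreAtCritical_energy_bracket` — the stub is SANDWICHED between two pure zero-energy statements
  (two-sided drift of part 4, `Theorems/HardyZLehmerSplitSigmaLLaguerreEnergyDrift.lean`):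
  `(∀ crit. t > 3·10¹²: Σₙ Re Zₙ < −3/(t²+¼)) ⇒ STUB ⇒ (∀ crit. t > 3·10¹²: Σₙ Re Zₙ ≤ −1/(t²+¼))`;
  and `energySurplus_of_riemannHypothesis`: RH ⇒ the surplus at EVERY `t ≥ 3·10¹²` with `Z(t) ≠ 0` (so the
  bracket costs nothing beyond RH); `critical_unique_of_energy`: under a surplus, at most one critical
  point per zero-free interval (Hall-type interlacing, windowed).

The energy hypotheses are RH-strength above the Platt–Trudgian height (an off-line zero straight above a
critical point at horizontal distance `δ` contributes `−1/δ²`); these are REDUCTIONS crediting nothing.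
NOTHING HERE PROVES OR ASSUMES RH; the stub and the crux stay OPEN. [cite: Ivic2003, §2 Prop. 1]
-/

noncomputable section

set_option linter.dupNamespace false
set_option autoImplicit false

open Complex Filter Set
open scoped Real Topology
open Literature.NumberTheory.LFunctions
open Literature.NumberTheory.LFunctions.Stark1974

namespace Summit.RiemannHypothesis.RiemannHypothesis.Theorems.SigmaLBirth

variable (D : SymmHadamardData riemannXi)

/-- **The registered stub's statement from an ENERGY SURPLUS at critical points (RH-free reduction):**
if at every critical point `t > 3·10¹²` of `Z` with `Z(t) ≠ 0` one has `Σₙ Re Zₙ(1, ½+it) < −4/t`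
(total zero energy above the drift), then `∀ t > 3·10¹², Z'(t) = 0 → Z(t) ≠ 0 → Z(t)·Z''(t) < 0` —
literally the signature of `stub_laguerreAtCritical`. The hypothesis is RH-strength; the stub stays
OPEN; nothing here bears on the truth of RH. [cite: Ivic2003, §2 Prop. 1 (energy form)] -/
theorem laguerreAtCritical_of_energySurplus
    (hE : ∀ t : ℝ, 3000000000000 < t → deriv hardyZ t = 0 → hardyZ t ≠ 0 →
      ∑' n, (D.zeroTerm 1 (1 / 2 + (t : ℂ) * I) n).re < -(4 / t)) :
    ∀ t : ℝ, 3000000000000 < t → deriv hardyZ t = 0 → hardyZ t ≠ 0 →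
      hardyZ t * deriv (deriv hardyZ) t < 0 :=
  fun t ht hd hZ ↦ laguerreAtCritical_of_energy D (by linarith) hd hZ (hE t ht hd hZ)

/-- **`SigmaL` BY NAME from an energy surplus at the critical points above `3·10¹²`**
(`laguerreAtCritical_of_energySurplus` + `SigmaL_of_laguerreAtCritical`). RH-strength hypothesis;
a reduction crediting nothing; nothing here bears on the truth of RH. [cite: Ivic2003, §2 Prop. 1] -/
theorem SigmaL_of_energySurplus_critical
    (hE : ∀ t : ℝ, 3000000000000 < t → deriv hardyZ t = 0 → hardyZ t ≠ 0 →
      ∑' n, (D.zeroTerm 1 (1 / 2 + (t : ℂ) * I) n).re < -(4 / t)) :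
    Summit.RiemannHypothesis.RiemannHypothesis.Theses.HardyZLehmerSplit.SigmaL :=
  SigmaL_of_laguerreAtCritical (laguerreAtCritical_of_energySurplus D hE)

/-- **`SigmaL` BY NAME from an energy surplus off the zeros of `Z` above `3·10¹²`** (window form:
`noViolationOn_of_energy` on `(3·10¹², t + 1)`; here the surplus is asked at every `t` with `Z(t) ≠ 0`,
which makes `Z'/Z` strictly decreasing between consecutive zeros — the energy form of Ivić's monotonicity).
RH-strength hypothesis; a reduction crediting nothing; nothing here bears on the truth of RH.
[cite: Ivic2003, §2 Prop. 1 (energy form, windowed)] -/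
theorem SigmaL_of_energySurplus
    (hE : ∀ t : ℝ, 3000000000000 < t → hardyZ t ≠ 0 →
      ∑' n, (D.zeroTerm 1 (1 / 2 + (t : ℂ) * I) n).re < -(4 / t)) :
    Summit.RiemannHypothesis.RiemannHypothesis.Theses.HardyZLehmerSplit.SigmaL := by
  intro t ht
  exact noViolationOn_of_energy D (A := 3000000000000) (B := t + 1) (by norm_num)
    (fun u hu hZu ↦ hE u hu.1 hZu) t ht (by linarith)

/-- **The registered stub, EXACTLY, as a statement about the zeros (RH-free equivalence):**
`(∀ t > 3·10¹², Z'(t) = 0 → Z(t) ≠ 0 → Z(t)·Z''(t) < 0) ↔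
 (∀ t > 3·10¹², Z'(t) = 0 → Z(t) ≠ 0 → Σₙ Re Zₙ(1, ½+it) + c'(t) < 0)`,
`c'(t) = deriv (u ↦ −2u/(u²+¼) + ½ Im ψ(¼ + iu/2)) t` the Gamma drift (`≤ 4/t`): the stub says precisely that
at every critical point above the Platt–Trudgian seam the total zero energy beats the drift
(`laguerreAtCritical_iff_energy` pointwise). A reformulation for the planner, not a proof; the stub stays
OPEN; nothing here bears on the truth of RH. [cite: Ivic2003, §2 Prop. 1 (energy form)] -/
theorem laguerreAtCritical_iff_energy_all :
    (∀ t : ℝ, 3000000000000 < t → deriv hardyZ t = 0 → hardyZ t ≠ 0 →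
      hardyZ t * deriv (deriv hardyZ) t < 0) ↔
    (∀ t : ℝ, 3000000000000 < t → deriv hardyZ t = 0 → hardyZ t ≠ 0 →
      (∑' n, (D.zeroTerm 1 (1 / 2 + (t : ℂ) * I) n).re) +
          deriv (fun u : ℝ ↦ -(2 * u / (u ^ 2 + 1 / 4)) +
            (Complex.digamma ((1 / 4 : ℂ) + ((u / 2 : ℝ) : ℂ) * I)).im / 2) t < 0) := by
  refine forall_congr' fun t ↦ forall_congr' fun _ ↦ forall_congr' fun hd ↦ forall_congr' fun hZ ↦ ?_
  exact laguerreAtCritical_iff_energy D hd hZ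

/-- **Sharp sufficient condition, by name:** the registered stub's statement from the energy surplus
`Σₙ Re Zₙ(1, ½+it) < −3/(t²+¼)` at every critical point `t > 3·10¹²` with `Z(t) ≠ 0`
(`laguerreAtCritical_of_energy_sharp`). RH-strength hypothesis; the stub stays OPEN; nothing here bears on
the truth of RH. [cite: Ivic2003, §2 Prop. 1 (energy form)] -/
theorem laguerreAtCritical_of_energySurplus_sharp
    (hE : ∀ t : ℝ, 3000000000000 < t → deriv hardyZ t = 0 → hardyZ t ≠ 0 →
      ∑' n, (D.zeroTerm 1 (1 / 2 + (t : ℂ) * I) n).re < -(3 / (t ^ 2 + 1 / 4))) :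
    ∀ t : ℝ, 3000000000000 < t → deriv hardyZ t = 0 → hardyZ t ≠ 0 →
      hardyZ t * deriv (deriv hardyZ) t < 0 :=
  fun t ht hd hZ ↦ laguerreAtCritical_of_energy_sharp D (by linarith) hd hZ (hE t ht hd hZ)

/-- **Necessary condition, by name (RH-free implication):** IF the registered stub's statement holds, then
at every critical point `t > 3·10¹²` of `Z` with `Z(t) ≠ 0` the zeros carry an energy surplus of at least
the drift floor: `Σₙ Re Zₙ(1, ½+it) ≤ −1/(t²+¼)` (`tsum_re_zeroTerm_le_of_rightCurvature`). A consequence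
OF the stub, crediting nothing toward it; nothing here bears on the truth of RH.
[cite: Ivic2003, §2 Prop. 1 (energy form, converse direction)] -/
theorem tsum_re_zeroTerm_le_of_laguerreAtCritical_all
    (hL : ∀ t : ℝ, 3000000000000 < t → deriv hardyZ t = 0 → hardyZ t ≠ 0 →
      hardyZ t * deriv (deriv hardyZ) t < 0) :
    ∀ t : ℝ, 3000000000000 < t → deriv hardyZ t = 0 → hardyZ t ≠ 0 →
      ∑' n, (D.zeroTerm 1 (1 / 2 + (t : ℂ) * I) n).re ≤ -(1 / (t ^ 2 + 1 / 4)) :=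
  fun t ht hd hZ ↦ tsum_re_zeroTerm_le_of_rightCurvature D (by linarith) hd hZ (hL t ht hd hZ).le

/-- **THE ENERGY BRACKET of `stub_laguerreAtCritical` (RH-free):** writing `R(t) = Σₙ Re Zₙ(1, ½+it)`
(minus the total zero energy at `t`) and quantifying over the critical points `t > 3·10¹²` of `Z` with
`Z(t) ≠ 0`:  `(∀ t, R(t) < −3/(t²+¼)) → STUB` and `STUB → (∀ t, R(t) ≤ −1/(t²+¼))`. The registered stub is
thus a statement about the ZEROS OF `ζ` ALONE up to a sliver of width `2/(t²+¼)` in the energy (the exact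
threshold being `−c'(t)`, `laguerreAtCritical_iff_energy_all`). For the planner: the RH-free residual of the
crux is "positive zero energy (`> 3/t²`) at every critical point of `Z` above the Platt–Trudgian height".
The stub stays OPEN; nothing here bears on the truth of RH. [cite: Ivic2003, §2 Prop. 1 (energy form)] -/
theorem laguerreAtCritical_energy_bracket :
    ((∀ t : ℝ, 3000000000000 < t → deriv hardyZ t = 0 → hardyZ t ≠ 0 →
        ∑' n, (D.zeroTerm 1 (1 / 2 + (t : ℂ) * I) n).re < -(3 / (t ^ 2 + 1 / 4))) →
      ∀ t : ℝ, 3000000000000 < t → deriv hardyZ t = 0 → hardyZ t ≠ 0 →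
        hardyZ t * deriv (deriv hardyZ) t < 0) ∧
    ((∀ t : ℝ, 3000000000000 < t → deriv hardyZ t = 0 → hardyZ t ≠ 0 →
        hardyZ t * deriv (deriv hardyZ) t < 0) →
      ∀ t : ℝ, 3000000000000 < t → deriv hardyZ t = 0 → hardyZ t ≠ 0 →
        ∑' n, (D.zeroTerm 1 (1 / 2 + (t : ℂ) * I) n).re ≤ -(1 / (t ^ 2 + 1 / 4))) :=
  ⟨laguerreAtCritical_of_energySurplus_sharp D, tsum_re_zeroTerm_le_of_laguerreAtCritical_all D⟩

/-- **`SigmaL ⇒` no energy-deficit critical points above `3·10¹²` (RH-free consequence of the crux):**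
under `SigmaL`, no critical point `t > 3·10¹²` of `Z` with `Z(t) ≠ 0` has `Σₙ Re Zₙ(1, ½+it) > −1/(t²+¼)`
(such a point would be a Lehmer violation, `lehmerViolation_of_energyDeficit`). The consequence side of the
bracket for the CRUX itself (the crux does not control degenerate critical points, so only the strict deficit
is excluded). Nothing here bears on the truth of RH. [cite: Ivic2003, §2 Prop. 1 (energy form)] -/
theorem not_energyDeficit_of_SigmaL
    (hL : Summit.RiemannHypothesis.RiemannHypothesis.Theses.HardyZLehmerSplit.SigmaL) :
    ∀ t : ℝ, 3000000000000 < t → deriv hardyZ t = 0 → hardyZ t ≠ 0 →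
      ∑' n, (D.zeroTerm 1 (1 / 2 + (t : ℂ) * I) n).re ≤ -(1 / (t ^ 2 + 1 / 4)) := by
  intro t ht hd hZ
  by_contra hlt
  push Not at hlt
  have hv := lehmerViolation_of_energyDeficit D (by linarith) hd hZ hlt
  have h := hL t ht
  rcases hv with ⟨hmin, hpos⟩ | ⟨hmax, hneg⟩
  · exact absurd (h.1 hmin) (not_le.2 hpos)
  · exact absurd (h.2 hmax) (not_le.2 hneg)

/-- **At most one critical point per zero-free interval under an energy surplus (RH-free; Hall-type
interlacing, windowed):** on a zero-free interval `(a, a')` of `Z` (`a ≥ 1`) where the total zero energy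
exceeds the drift at every point, `Z'/Z` is strictly decreasing (`strictAntiOn_hardyZ_logDeriv_of_energy`),
so `Z'` vanishes at most once in `(a, a')`: between consecutive zeros of `Z` there is exactly one critical
point (existence by Rolle), the classical RH-picture of the graph of `Z`, here from the energy hypothesis
alone. Nothing here bears on the truth of RH. [cite: Ivic2003, §2 Prop. 1 (energy form, local)] -/
theorem critical_unique_of_energy {a a' t₁ t₂ : ℝ} (ha : 1 ≤ a)
    (hfree : ∀ u ∈ Ioo a a', hardyZ u ≠ 0)
    (hE : ∀ u ∈ Ioo a a', ∑' n, (D.zeroTerm 1 (1 / 2 + (u : ℂ) * I) n).re < -(4 / u))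
    (h₁ : t₁ ∈ Ioo a a') (h₂ : t₂ ∈ Ioo a a') (hd₁ : deriv hardyZ t₁ = 0) (hd₂ : deriv hardyZ t₂ = 0) :
    t₁ = t₂ := by
  have hanti := strictAntiOn_hardyZ_logDeriv_of_energy D ha hfree hE
  apply hanti.injOn h₁ h₂
  simp only [hd₁, hd₂, zero_div]

/-! ## The top of the bracket is RH-implied: under RH every `t ≥ 3·10¹²` off the zeros of `Z` has surplus -/

/-- Every Hadamard node carries a zero of `ξ`: `ξ(½ + ζₙ) = 0` when `cₙ ≠ 0` (the `n`-th factor of the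
product vanishes there). [cite: Conway1978, Ch. XI Thm. 3.4] -/
theorem riemannXi_half_add_node {n : ℕ} (hn : D.c n ≠ 0) : riemannXi (1 / 2 + D.node n) = 0 := by
  have hfac : 1 + D.c n * D.node n ^ 2 = 0 := by linear_combination D.c_mul_node_sq hn
  have hP : ∏' k, (1 + D.c k * D.node n ^ 2) = 0 :=
    (D.hasProd (D.node n)).unique (hasProd_zero_of_exists_eq_zero ⟨n, hfac⟩)
  rw [D.prod_eq (D.node n), hP, mul_zero, mul_zero]

/-- **Under RH the nodes are purely imaginary**: `Re ζₙ = 0` (`½ + ζₙ` is a nontrivial zero of `ζ`).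
CONDITIONAL on RH. [folklore] -/
theorem node_re_eq_zero_of_riemannHypothesis (hRH : RiemannHypothesis) {n : ℕ} (hn : D.c n ≠ 0) :
    (D.node n).re = 0 := by
  obtain ⟨hζ, h0, h1⟩ := (riemannXi_eq_zero_iff_holds _).1 (riemannXi_half_add_node D hn)
  have h0' : 0 < 1 / 2 + (D.node n).re := by simpa using h0
  have h1' : 1 / 2 + (D.node n).re < 1 := by simpa using h1
  have hre := hRH _ hζ (by
      rintro ⟨m, hm⟩
      have h := congrArg Complex.re hm
      simp at h
      have : (0 : ℝ) ≤ m := m.cast_nonneg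
      linarith) (by
      intro h
      have h' := congrArg Complex.re h
      simp at h'
      linarith)
  have : (1 / 2 + D.node n : ℂ).re = 1 / 2 + (D.node n).re := by simp
  rw [this] at hre
  linarith

/-- `(0² − u²)/((0² + u²)²) = −1/u²` (both sides `0` at `u = 0`). [folklore] -/
theorem zero_sq_sub_div (u : ℝ) : ((0 : ℝ) ^ 2 - u ^ 2) / ((0 : ℝ) ^ 2 + u ^ 2) ^ 2 = -(1 / u ^ 2) := by
  rcases eq_or_ne u 0 with rfl | hu
  · simp
  · have hu2 : u ^ 2 ≠ 0 := pow_ne_zero 2 hu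
    field_simp
    ring

/-- **Under RH every pair term is `−1/(t−γₙ)² − 1/(t+γₙ)² ≤ 0`** (all zeros on the line: pure energy, no
in-cone penalty anywhere). CONDITIONAL on RH. [cite: Ivic2003, §2 (2.1) under RH] -/
theorem re_zeroTerm_one_nonpos_of_riemannHypothesis (hRH : RiemannHypothesis) (n : ℕ) (t : ℝ) :
    (D.zeroTerm 1 (1 / 2 + (t : ℂ) * I) n).re ≤ 0 := by
  by_cases hn : D.c n = 0
  · simp [SymmHadamardData.zeroTerm, hn]
  rw [re_zeroTerm_one_eq D hn, node_re_eq_zero_of_riemannHypothesis D hRH hn, zero_sq_sub_div,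
    zero_sq_sub_div]
  have h1 : 0 ≤ 1 / (t - (D.node n).im) ^ 2 := by positivity
  have h2 : 0 ≤ 1 / (t + (D.node n).im) ^ 2 := by positivity
  linarith

/-- **RH ⇒ ENERGY SURPLUS above `3·10¹²` (the top of the bracket is RH-implied):** under RH, at every
`t ≥ 3·10¹²` with `Z(t) ≠ 0`, `Σₙ Re Zₙ(1, ½+it) < −3/(t²+¼)`: every term is `≤ 0` and the RH-free zero
`ρ₀` with `t < γ₀ ≤ t + 8` (`SigmaLRung.zetaZeroCount_lt_add_eight`) alone contributes `≤ −1/64`. So the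
chain reads `RH ⇒ (surplus everywhere) ⇒ stub ⇒ (floor at critical points)`: the energy statements
bracketing the stub are themselves RH-consequences, i.e. the bracket costs nothing beyond RH. CONDITIONAL
on RH; credits nothing; nothing here bears on the truth of RH. [cite: Ivic2003, §2 Prop. 1] -/
theorem energySurplus_of_riemannHypothesis (hRH : RiemannHypothesis) {t : ℝ}
    (ht : 3000000000000 ≤ t) (hZ : hardyZ t ≠ 0) :
    ∑' n, (D.zeroTerm 1 (1 / 2 + (t : ℂ) * I) n).re < -(3 / (t ^ 2 + 1 / 4)) := by
  obtain ⟨ρ₀, hρ₀, hγt, hγ8⟩ :=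
    SigmaLRung.exists_zero_of_count_lt (by norm_num) (SigmaLRung.zetaZeroCount_lt_add_eight ht)
  have him0 : ρ₀.im ≠ 0 := by intro h; rw [h] at hγt; linarith
  obtain ⟨h0, h1⟩ := re_mem_Ioo_of_riemannZeta_eq_zero_of_im_ne_zero hρ₀ him0
  have hξ0 : riemannXi ρ₀ = 0 := (riemannXi_eq_zero_iff_holds _).2 ⟨hρ₀, h0, h1⟩
  have hρhalf : ρ₀ ≠ 1 / 2 := by
    intro h
    have := congrArg Complex.im h
    simp at this
    exact him0 this
  obtain ⟨n₀, hn₀, hroot⟩ := D.exists_index_of_zero hξ0 hρhalf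
  have hre : ρ₀.re = 1 / 2 := hRH ρ₀ hρ₀ (by
      rintro ⟨m, hm⟩
      have h := congrArg Complex.re hm
      simp at h
      have : (0 : ℝ) ≤ m := m.cast_nonneg
      linarith) (by
      intro h
      have h' := congrArg Complex.re h
      simp at h'
      linarith)
  -- the `n₀` term alone is `≤ −1/64`
  have hterm : (D.zeroTerm 1 (1 / 2 + (t : ℂ) * I) n₀).re ≤ -(1 / 64) := by
    rw [re_zeroTerm_one_eq_of_root D hroot, hre]
    have e1 : ((1 / 2 - 1 / 2 : ℝ) ^ 2 - (t - ρ₀.im) ^ 2) / ((1 / 2 - 1 / 2 : ℝ) ^ 2 + (t - ρ₀.im) ^ 2) ^ 2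
        = -(1 / (t - ρ₀.im) ^ 2) := by
      rw [show (1 / 2 - 1 / 2 : ℝ) = 0 by norm_num]; exact zero_sq_sub_div _
    have e2 : ((1 / 2 - 1 / 2 : ℝ) ^ 2 - (t + ρ₀.im) ^ 2) / ((1 / 2 - 1 / 2 : ℝ) ^ 2 + (t + ρ₀.im) ^ 2) ^ 2
        = -(1 / (t + ρ₀.im) ^ 2) := by
      rw [show (1 / 2 - 1 / 2 : ℝ) = 0 by norm_num]; exact zero_sq_sub_div _
    rw [e1, e2]
    have hsq : (t - ρ₀.im) ^ 2 ≤ 64 := by nlinarith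
    have hsqpos : 0 < (t - ρ₀.im) ^ 2 := by
      have : t - ρ₀.im ≠ 0 := by intro h; linarith
      positivity
    have h64 : 1 / 64 ≤ 1 / (t - ρ₀.im) ^ 2 := by
      rw [div_le_div_iff₀ (by norm_num) hsqpos]; linarith
    have h2 : 0 ≤ 1 / (t + ρ₀.im) ^ 2 := by positivity
    linarith
  have hsum := tsum_re_zeroTerm_le_sum D hZ {n₀}
    (fun n _ ↦ re_zeroTerm_one_nonpos_of_riemannHypothesis D hRH n t)
  rw [Finset.sum_singleton] at hsum
  have h3 : 3 / (t ^ 2 + 1 / 4) < 1 / 64 := by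
    rw [div_lt_div_iff₀ (by positivity) (by norm_num)]
    nlinarith
  linarith

/-! ## Appendix: the crux `SigmaL` itself sits in the same energy bracket as the stub -/

/-- **THE ENERGY BRACKET of the crux `SigmaL` (RH-free):** with `R(t) = Σₙ Re Zₙ(1, ½+it)` over the
critical points `t > 3·10¹²` of `Z` with `Z(t) ≠ 0`:
`(∀ t, R(t) < −3/(t²+¼)) → SigmaL` (`SigmaL_of_energySurplus_critical` sharpened via
`laguerreAtCritical_of_energySurplus_sharp` + `SigmaL_of_laguerreAtCritical`) and
`SigmaL → (∀ t, R(t) ≤ −1/(t²+¼))` (`not_energyDeficit_of_SigmaL`). Together with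
`laguerreAtCritical_energy_bracket`: the crux `SigmaL` and the registered stub `stub_laguerreAtCritical`
are BOTH squeezed between the same two statements about the zeros of `ζ` alone — they can differ only
inside the energy sliver `1/(t²+¼) ≤ −R(t) ≤ 3/(t²+¼)` (where the exact threshold `−c'(t)` and the
degenerate critical points live). For the planner: up to that sliver, `SigmaL ≡ stub ≡` "zero energy `> c'(t)`
at every critical point of `Z` above the Platt–Trudgian seam". Credits nothing; the crux stays OPEN; nothing
here bears on the truth of RH. [cite: Ivic2003, §2 Prop. 1 (energy form)] -/
theorem SigmaL_energy_bracket :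
    ((∀ t : ℝ, 3000000000000 < t → deriv hardyZ t = 0 → hardyZ t ≠ 0 →
        ∑' n, (D.zeroTerm 1 (1 / 2 + (t : ℂ) * I) n).re < -(3 / (t ^ 2 + 1 / 4))) →
      Summit.RiemannHypothesis.RiemannHypothesis.Theses.HardyZLehmerSplit.SigmaL) ∧
    (Summit.RiemannHypothesis.RiemannHypothesis.Theses.HardyZLehmerSplit.SigmaL →
      ∀ t : ℝ, 3000000000000 < t → deriv hardyZ t = 0 → hardyZ t ≠ 0 →
        ∑' n, (D.zeroTerm 1 (1 / 2 + (t : ℂ) * I) n).re ≤ -(1 / (t ^ 2 + 1 / 4))) :=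
  ⟨fun hE ↦ SigmaL_of_laguerreAtCritical (laguerreAtCritical_of_energySurplus_sharp D hE),
    not_energyDeficit_of_SigmaL D⟩

end Summit.RiemannHypothesis.RiemannHypothesis.Theorems.SigmaLBirth

end
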